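import Summits.Parity.BatemanHorn.Theorems.NormalFamilyBound.Negative.RealAxis

/-!
# `NormalFamilyBound` — negative lemmas II: load-bearing hypotheses and tightness of the radius

Support (negative side) for crux `stmt-Parity-9769`
(`Summit.Parity.BatemanHorn.Theses.SelbergDelangeRigidity.NormalFamilyBound`). With the vocabulary of
`Negative/RealAxis.lean` (`V`, `H`, `Ωf`, `locallyBoundedSystems`, the witness systems):

* `normalFamilyBound_false_without_irreducible` (`f = (1)`; `…'`: `f = (X²)`),
  `…_without_leadingCoeffPos` (`f = (−X)`), `…_without_pairwiseNotAssociated` (`f = (X, X)`),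
  `…_without_noFixedPrimeDivisor` (`f = (2)`): the crux with one field of `IsBatemanHornSystem` dropped is
  FALSE — every field is used by any proof (for non-constant systems `hasNoFixedPrimeDivisor` is only shown
  necessary through the constant witness; see the docstring);
* `normalFamilyBoundRadius_false` — with `7/4` replaced by any `R > 2` the statement is false already for the
  genuine Bateman–Horn system `f = (X)` (single term `n = 2^m`; Montgomery–Vaughan, Multiplicative Number
  Theory I, Thm 7.18: "the restriction `R < 2` is necessary").

Standing disprover's work file: `Summits/Parity/BatemanHorn/Cruxes/NormalFamilyBound/Disproof.lean`.
-/

namespace Summit.Parity.BatemanHorn.Theorems.NormalFamilyBound.Negative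

open Literature.NumberTheory.Sieve Polynomial Finset Filter
open Summit.Parity.BatemanHorn.Theses.SelbergDelangeRigidity
open Summit.Parity.BatemanHorn.Theorems.SystemLSDRealSegment.Negative (tendsto_loglog_atTop)

noncomputable section

/-! ## Load-bearing analysis: each field of `IsBatemanHornSystem` is used

For each field `F` of `IsBatemanHornSystem`, `normalFamilyBound_false_without_F` refutes the crux with that
field dropped: a system satisfying the other three fields whose family blows up at a REAL point of `[0, 7/4)`.

### The blow-ups -/

/-- At `z = 0` with `Ω_f ≡ 0`: `‖H_x(0)‖ = (x+1)/x · exp(k · log log x) ≥ exp(k log log x)`. [folklore] -/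
theorem norm_H_at_zero_of_Ωf_zero {k : ℕ} {f : Fin k → ℤ[X]} (hΩ : ∀ n, Ωf f n = 0) (x : ℕ)
    (hx : 1 ≤ x) : Real.exp (k * Real.log (Real.log x)) ≤ ‖H k f x (0 : ℝ)‖ := by
  rw [norm_H_ofReal _ _ _ le_rfl]
  simp only [hΩ, pow_zero, sum_const, card_range, nsmul_eq_mul, mul_one, sub_zero]
  have hx' : (0 : ℝ) < x := by exact_mod_cast hx
  rw [mul_comm ((x : ℝ)⁻¹), mul_assoc]
  refine le_mul_of_one_le_right (Real.exp_nonneg _) ?_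
  rw [le_inv_mul_iff₀ hx']; push_cast; linarith

/-- `Ω_f ≡ 0`, `k ≥ 1` ⇒ `sup_x ‖H_x(0)‖ = ∞`. [folklore] -/
theorem unbounded_at_zero_of_Ωf_zero {k : ℕ} (hk : 1 ≤ k) {f : Fin k → ℤ[X]} (hΩ : ∀ n, Ωf f n = 0) :
    ∀ M : ℝ, ∃ x : ℕ, M < ‖H k f x (0 : ℝ)‖ := by
  refine unbounded_of_tendsto (fun x : ℕ => Real.exp (k * Real.log (Real.log x))) id ?_ ?_
  · exact Real.tendsto_exp_atTop.comp (tendsto_loglog_atTop.const_mul_atTop (by exact_mod_cast hk))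
  · filter_upwards [eventually_ge_atTop 1] with x hx using norm_H_at_zero_of_Ωf_zero hΩ x hx

/-- LOAD-BEARING `irreducible` (constant witness): for `f = (1)` one has `Ω_f ≡ 0`, so
`H_x(0) = (x+1) x⁻¹ log x → ∞` at the point `0 ∈ V_η`. Any proof must use that the `f_i` are
non-units. [folklore] -/
theorem normalFamilyBound_false_without_irreducible :
    ¬ ∀ (k : ℕ) (f : Fin k → ℤ[X]), (∀ i, 0 < (f i).leadingCoeff) →
      (Pairwise fun i j ↦ ¬Associated (f i) (f j)) → HasNoFixedPrimeDivisor f →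
      f ∈ locallyBoundedSystems (7 / 4) k := by
  intro h
  refine not_mem_locallyBoundedSystems_of_unbounded 0 le_rfl (by norm_num)
    (unbounded_at_zero_of_Ωf_zero le_rfl Ωf_fOne) (h 1 fOne ?_ (Subsingleton.pairwise)
      hasNoFixedPrimeDivisor_fOne)
  intro i; fin_cases i; simp [fOne]

/-- LOAD-BEARING `leadingCoeff_pos`: for `f = (−X)` every value is `≤ 0`, `toNat` makes it `0` and
`Ω 0 = 0`, so again `Ω_f ≡ 0` and `H_x(0) → ∞`. (The blow-up exploits the `toNat` junk convention;
with `|f_i(n)|` in place of `toNat` the system `(−X)` would behave like `(X)`. So this field is used,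
but only through the sign convention.) [folklore] -/
theorem normalFamilyBound_false_without_leadingCoeffPos :
    ¬ ∀ (k : ℕ) (f : Fin k → ℤ[X]), (∀ i, Irreducible (f i)) →
      (Pairwise fun i j ↦ ¬Associated (f i) (f j)) → HasNoFixedPrimeDivisor f →
      f ∈ locallyBoundedSystems (7 / 4) k := by
  intro h
  refine not_mem_locallyBoundedSystems_of_unbounded 0 le_rfl (by norm_num)
    (unbounded_at_zero_of_Ωf_zero le_rfl Ωf_fNegX) (h 1 fNegX ?_ (Subsingleton.pairwise)
      hasNoFixedPrimeDivisor_fNegX)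
  intro i; fin_cases i
  simpa [fNegX] using (Associated.refl (X : ℤ[X])).neg_right.irreducible irreducible_X

/-- At `z = 1/2` with `Ω_f ≡ 1`: `‖H_x(1/2)‖ = (x+1)/(2x) · exp(k/2 · log log x)`. [folklore] -/
theorem norm_H_at_half_of_Ωf_one {k : ℕ} {f : Fin k → ℤ[X]} (hΩ : ∀ n, Ωf f n = 1) (x : ℕ)
    (hx : 1 ≤ x) : Real.exp (k * (1 / 2) * Real.log (Real.log x)) / 2 ≤ ‖H k f x (1 / 2 : ℝ)‖ := by
  rw [norm_H_ofReal _ _ _ (by norm_num)]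
  simp only [hΩ, pow_one, sum_const, card_range, nsmul_eq_mul]
  have hx' : (0 : ℝ) < x := by exact_mod_cast hx
  have hx1 : (1 : ℝ) ≤ x := by exact_mod_cast hx
  rw [show (1 : ℝ) - 1 / 2 = 1 / 2 by norm_num]
  rw [show (x : ℝ)⁻¹ * Real.exp (k * (1 / 2) * Real.log (Real.log x)) * (((x + 1 : ℕ) : ℝ) * (1 / 2))
      = Real.exp (k * (1 / 2) * Real.log (Real.log x)) / 2 * ((x : ℝ)⁻¹ * ((x + 1 : ℕ) : ℝ)) by ring]
  refine le_mul_of_one_le_right (by positivity) ?_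
  rw [le_inv_mul_iff₀ hx']; push_cast; linarith

/-- LOAD-BEARING `hasNoFixedPrimeDivisor` (constant witness): `f = (2)` is irreducible in `ℤ[X]`
with positive leading coefficient, `Ω_f ≡ 1`, and `H_x(1/2) = (x+1)/(2x) (log x)^{1/2} → ∞`.
NOTE for provers: this only shows the field is used to exclude CONSTANTS. For a NON-constant system
with a fixed prime divisor (e.g. `X² + X + 2`, always even) the family is plausibly still locally
bounded (a fixed prime shifts `Ω_f` by a bounded amount in mean, changing constants, not orders):
for non-constant systems `hasNoFixedPrimeDivisor` is possibly unnecessary for THIS crux (it is of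
course essential for Bateman–Horn itself, via `C(f) > 0`). [folklore] -/
theorem normalFamilyBound_false_without_noFixedPrimeDivisor :
    ¬ ∀ (k : ℕ) (f : Fin k → ℤ[X]), (∀ i, Irreducible (f i)) → (∀ i, 0 < (f i).leadingCoeff) →
      (Pairwise fun i j ↦ ¬Associated (f i) (f j)) →
      f ∈ locallyBoundedSystems (7 / 4) k := by
  intro h
  have hB := h 1 fTwo ?_ ?_ (Subsingleton.pairwise)
  · refine not_mem_locallyBoundedSystems_of_unbounded (1 / 2) (by norm_num) (by norm_num) ?_ hB
    refine unbounded_of_tendsto (fun x : ℕ => Real.exp ((1 : ℕ) * (1 / 2) * Real.log (Real.log x)) / 2)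
      id ?_ ?_
    · refine Tendsto.atTop_div_const (by norm_num) ?_
      exact Real.tendsto_exp_atTop.comp (tendsto_loglog_atTop.const_mul_atTop (by norm_num))
    · filter_upwards [eventually_ge_atTop 1] with x hx using norm_H_at_half_of_Ωf_one Ωf_fTwo x hx
  · intro i; fin_cases i
    simpa [fTwo] using (Polynomial.prime_C_iff.mpr Int.prime_two).irreducible
  · intro i; fin_cases i
    simp only [fTwo, Matrix.cons_val_fin_one, leadingCoeff_C]
    norm_num

/-- The `2^m` mechanism (triager r1-1's finding F1, formalised): if `Ω_f(2^m) ≥ c·m`... we only need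
the two concrete instances below, stated via a common estimate: at the real point `a = 3/2` and
`x = 2^m`, a single term `n = 2^m` with `Ω_f(n) = 2m` already gives
`‖H_x(3/2)‖ ≥ 2^{−m} · (log x)^{−k/2} · (9/4)^m ≥ (9/8)^m / (m log 2)` (for `k ≤ 2`, `m ≥ 2`). [folklore] -/
theorem norm_H_three_halves_ge {k : ℕ} (hk : k ≤ 2) {f : Fin k → ℤ[X]}
    (hΩ : ∀ n, Ωf f n = 2 * ArithmeticFunction.cardFactors n) (m : ℕ) (hm : 2 ≤ m) :
    (9 / 8 : ℝ) ^ m / (m * Real.log 2) ≤ ‖H k f (2 ^ m) (3 / 2 : ℝ)‖ := by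
  rw [norm_H_ofReal _ _ _ (by norm_num), log_two_pow]
  have hL1 : 1 ≤ (m : ℝ) * Real.log 2 := one_le_mul_log_two hm
  have hL0 : 0 < (m : ℝ) * Real.log 2 := by linarith
  have hlog0 : 0 ≤ Real.log ((m : ℝ) * Real.log 2) := Real.log_nonneg hL1
  -- the exponential factor is at least exp(-log(m log 2)) = (m log 2)⁻¹
  have hexp : ((m : ℝ) * Real.log 2)⁻¹ ≤ Real.exp (k * (1 - (3 / 2 : ℝ)) * Real.log (m * Real.log 2)) := by
    have : ((m : ℝ) * Real.log 2)⁻¹ = Real.exp (-Real.log (m * Real.log 2)) := by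
      rw [Real.exp_neg, Real.exp_log hL0]
    rw [this]
    refine Real.exp_le_exp.mpr ?_
    have hk' : (k : ℝ) ≤ 2 := by exact_mod_cast hk
    nlinarith
  -- the sum is at least its term n = 2^m
  have hterm : (3 / 2 : ℝ) ^ Ωf f (2 ^ m) ≤ ∑ n ∈ range (2 ^ m + 1), (3 / 2 : ℝ) ^ Ωf f n :=
    single_le_sum (f := fun n => (3 / 2 : ℝ) ^ Ωf f n) (fun n _ => by positivity) (by simp)
  rw [hΩ, ArithmeticFunction.cardFactors_apply_prime_pow Nat.prime_two, pow_mul] at hterm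
  norm_num at hterm
  calc (9 / 8 : ℝ) ^ m / (m * Real.log 2)
      = ((2 ^ m : ℕ) : ℝ)⁻¹ * ((m : ℝ) * Real.log 2)⁻¹ * (9 / 4 : ℝ) ^ m := by
        push_cast
        rw [div_eq_mul_inv, show (9 / 8 : ℝ) ^ m = ((2 : ℝ) ^ m)⁻¹ * (9 / 4) ^ m by
          rw [← inv_pow, ← mul_pow]; norm_num]
        ring
    _ ≤ _ := by gcongr

/-- `Ω_f = 2Ω`, `k ≤ 2` ⇒ `sup_x ‖H_x(3/2)‖ = ∞` (along `x = 2^m`). [folklore] -/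
theorem unbounded_three_halves {k : ℕ} (hk : k ≤ 2) {f : Fin k → ℤ[X]}
    (hΩ : ∀ n, Ωf f n = 2 * ArithmeticFunction.cardFactors n) :
    ∀ M : ℝ, ∃ x : ℕ, M < ‖H k f x (3 / 2 : ℝ)‖ := by
  refine unbounded_of_tendsto (fun m : ℕ => (9 / 8 : ℝ) ^ m / (m * Real.log 2)) (fun m => 2 ^ m)
    ?_ ?_
  · have h := (tendsto_geom_div_pow (by norm_num : (1 : ℝ) < 9 / 8) 1).atTop_div_const
      (Real.log_pos one_lt_two)
    refine h.congr' (Eventually.of_forall fun m => ?_)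
    simp only [pow_one]; ring
  · filter_upwards [eventually_ge_atTop 2] with m hm using norm_H_three_halves_ge hk hΩ m hm

/-- LOAD-BEARING `pairwise_not_associated`: for `f = (X, X)` (irreducible, monic, `ω(p) = 1 < p`)
`Ω_f(n) = 2Ω(n)` and the single term `n = 2^m ≤ x = 2^m` gives `‖H_x(3/2)‖ ≥ (9/8)^m/(m log 2) → ∞`
at the REAL point `3/2 ∈ (5/4, 7/4)` — inside the segment where LSDRealSegment lives. Mechanism:
repeating a component squares the weight, `(3/2)² = 9/4 > 2` crosses the `p = 2` radius. [folklore] -/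
theorem normalFamilyBound_false_without_pairwiseNotAssociated :
    ¬ ∀ (k : ℕ) (f : Fin k → ℤ[X]), (∀ i, Irreducible (f i)) → (∀ i, 0 < (f i).leadingCoeff) →
      HasNoFixedPrimeDivisor f →
      f ∈ locallyBoundedSystems (7 / 4) k := by
  intro h
  refine not_mem_locallyBoundedSystems_of_unbounded (3 / 2) (by norm_num) (by norm_num)
    (unbounded_three_halves le_rfl Ωf_fXX) (h 2 fXX ?_ ?_ hasNoFixedPrimeDivisor_fXX)
  · intro i; fin_cases i <;> simpa [fXX] using irreducible_X
  · intro i; fin_cases i <;> simp [fXX]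

/-- LOAD-BEARING `irreducible` (non-constant witness): `f = (X²)` is monic with `ω(p) = 1`, but
`Ω(n²) = 2Ω(n)` and the same `2^m` term blows up at `a = 3/2`. So irreducibility is used beyond
excluding constants: a square factor doubles the weight exponent. [folklore] -/
theorem normalFamilyBound_false_without_irreducible' :
    ¬ ∀ (k : ℕ) (f : Fin k → ℤ[X]), (∀ i, 0 < (f i).leadingCoeff) →
      (Pairwise fun i j ↦ ¬Associated (f i) (f j)) → HasNoFixedPrimeDivisor f →
      f ∈ locallyBoundedSystems (7 / 4) k := by
  intro h
  refine not_mem_locallyBoundedSystems_of_unbounded (3 / 2) (by norm_num) (by norm_num)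
    (unbounded_three_halves (by norm_num) Ωf_fXsq) (h 1 fXsq ?_ (Subsingleton.pairwise)
      hasNoFixedPrimeDivisor_fXsq)
  intro i; fin_cases i; simp [fXsq]

/-! ## Tightness of the right end: `7/4` cannot become any `R > 2`

(Triager r1-1's F1 for the GENUINE Bateman–Horn system `f = (X)`; Montgomery–Vaughan Thm 7.18:
"the restriction `R < 2` is necessary".) For real `y ∈ (2, R)`, the single term `n = 2^m` gives
`‖H_{2^m}(y)‖ ≥ (y/2)^m (m log 2)^{1−y} → ∞`. So the statement is false for every `R > 2`, and
the crux's `V_η ⊂ {|z| < 2}` (as `(7/4)² + (1/4)² < 4`) is essentially the maximal safe region. -/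
/-- For `f = (X)`, real `y ∈ (2, 3]`, `x = 2^m`: `‖H_x(y)‖ ≥ (y/2)^m / (m log 2)²`. [folklore] -/
theorem norm_H_fX_ge {y : ℝ} (hy2 : 2 < y) (hy3 : y ≤ 3) (m : ℕ) (hm : 2 ≤ m) :
    (y / 2) ^ m / ((m : ℝ) * Real.log 2) ^ 2 ≤ ‖H 1 fX (2 ^ m) y‖ := by
  rw [norm_H_ofReal _ _ _ (by linarith), log_two_pow]
  have hL1 : 1 ≤ (m : ℝ) * Real.log 2 := one_le_mul_log_two hm
  have hL0 : 0 < (m : ℝ) * Real.log 2 := by linarith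
  have hlog0 : 0 ≤ Real.log ((m : ℝ) * Real.log 2) := Real.log_nonneg hL1
  have hexp : (((m : ℝ) * Real.log 2) ^ 2)⁻¹ ≤
      Real.exp ((1 : ℕ) * (1 - y) * Real.log (m * Real.log 2)) := by
    rw [← Real.exp_log (by positivity : (0 : ℝ) < ((m : ℝ) * Real.log 2) ^ 2), ← Real.exp_neg,
      Real.log_pow]
    refine Real.exp_le_exp.mpr ?_
    push_cast
    nlinarith
  have hterm : y ^ Ωf fX (2 ^ m) ≤ ∑ n ∈ range (2 ^ m + 1), y ^ Ωf fX n :=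
    single_le_sum (f := fun n => y ^ Ωf fX n) (fun n _ => by positivity) (by simp)
  rw [Ωf_fX, ArithmeticFunction.cardFactors_apply_prime_pow Nat.prime_two] at hterm
  calc (y / 2) ^ m / ((m : ℝ) * Real.log 2) ^ 2
      = ((2 ^ m : ℕ) : ℝ)⁻¹ * (((m : ℝ) * Real.log 2) ^ 2)⁻¹ * y ^ m := by
        push_cast
        rw [div_pow, div_eq_mul_inv]
        ring
    _ ≤ _ := by gcongr

/-- TIGHTNESS OF THE RADIUS: for every `R > 2` the crux with `7/4 ↦ R` fails for the Bateman–Horn system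
`f = (X)`, at the real point `y = min((2+R)/2, 3) ∈ (2, R)`. [folklore] -/
theorem normalFamilyBoundRadius_false {R : ℝ} (hR : 2 < R) :
    ¬ ∀ (k : ℕ) (f : Fin k → ℤ[X]), IsBatemanHornSystem f → f ∈ locallyBoundedSystems R k := by
  intro h
  -- a real point y with 2 < y < R, y ≤ 3
  set y : ℝ := min ((2 + R) / 2) 3 with hy
  have hy2 : 2 < y := by rw [hy]; exact lt_min (by linarith) (by norm_num)
  have hyR : y < R := by rw [hy]; exact min_lt_of_left_lt (by linarith)
  have hy3 : y ≤ 3 := min_le_right _ _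
  refine not_mem_locallyBoundedSystems_of_unbounded y (by linarith) hyR ?_ (h 1 fX isBatemanHornSystem_fX)
  refine unbounded_of_tendsto (fun m : ℕ => (y / 2) ^ m / ((m : ℝ) * Real.log 2) ^ 2)
    (fun m => 2 ^ m) ?_ ?_
  · have h := (tendsto_geom_div_pow (by linarith : (1 : ℝ) < y / 2) 2).atTop_div_const
      (by positivity : (0 : ℝ) < Real.log 2 ^ 2)
    refine h.congr' (Eventually.of_forall fun m => ?_)
    simp only [mul_pow]; ring
  · filter_upwards [eventually_ge_atTop 2] with m hm using norm_H_fX_ge hy2 hy3 m hm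

end

end Summit.Parity.BatemanHorn.Theorems.NormalFamilyBound.Negative
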